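import Summits.HubbardSuperconductivity.HubbardSuperconductivity.Theorems.NodalDiracTwistBridgeNodalToDWaveRealMomentum
import Summits.HubbardSuperconductivity.HubbardSuperconductivity.Theorems.NodalDiracTwistDiskTrivialHolonomy

/-!
# Route `NodalDiracTwist`, crux `BridgeNodalToDWave` (stmt-HubbardSuperconductivity-10395) —
# helper: the crystal momentum of the sector ground state is locally constant in the twist

Line `birth`, lead c11 (`--supports stmt-HubbardSuperconductivity-10395`), sequel of
`NodalDiracTwistBridgeNodalToDWaveRealMomentum` (p150357).  There: at any twist `φ` at which the
`(N, S^z = 0)` sector ground state `χ` of `H_L(U,φ) = spinTwistedHubbardTorus L U φ` is unique up to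
scalars, `U_v χ = ± χ` for every translation `v` (real crystal momentum).  Here: **on any closed disk
of twists on which the sector ground state is unique, that sign does not depend on the twist**
(`fockTranslate_sign_const_on_disk`).  Mechanism: the uniform-overlap lemma of the route's
`DiskTrivialHolonomy` apparatus (`uniform_overlap`: on a compact disk of uniqueness, unit ground
states at nearby twists have overlap bounded away from `0`) and unitarity of `U_v`:
`⟨χ, χ'⟩ = ⟨U_v χ, U_v χ'⟩ = a a' ⟨χ, χ'⟩` with `⟨χ, χ'⟩ ≠ 0` forces `a = a'` for nearby twists; a chain
along the segment joining two twists of the disk propagates the sign.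

For the line: clause (I) of the nodal-Dirac package makes the sector ground state unique on every
closed disk of the twist cell avoiding the diagonal quartet `(±c, ±c)`, so the momentum
`K(φ) ∈ {0, π}²` of the ground state is constant on each such disk, hence (chaining overlapping
disks through the connected punctured cell) equal to the untwisted value `K(0) ∈ {0, (π,π)}`
(`NodalDiracTwistBridgeNodalToDWaveRealMomentumDiagonal`) everywhere off the quartet — lead c9's
audit item S3, now reduced to kernel-checked lemmas.  Sources: Y. Hatsugai, J. Phys. Soc. Jpn. 75
(2006) 123601; T. Kato, *Perturbation Theory for Linear Operators* (1966) II §5.1 (continuity of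
isolated eigenvectors — here in the compactness form `uniform_overlap`).  No new definitions, no
named facts.
-/

-- the mandated namespace `Summit.<Summit>.<Problem>.Theorems` repeats `HubbardSuperconductivity`
set_option linter.dupNamespace false

noncomputable section

namespace Summit.HubbardSuperconductivity.HubbardSuperconductivity.Theorems.NodalDiracTwist.BridgeNodalToDWave

open Matrix Literature.MathematicalPhysics.QuantumLattice Literature.Probability.LatticeModels HubbardWave0
open Summit.HubbardSuperconductivity.HubbardSuperconductivity.Theorems.NodalDiracTwist
open scoped ComplexOrder

/-! ### Segments inside a disk of twists -/

section Geometry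

/-- Convexity of the square: `((1-t)a + tb)² ≤ (1-t)a² + tb²` for `t ∈ [0,1]`. [folklore] -/
theorem sq_convex_comb_le {t : ℝ} (ht0 : 0 ≤ t) (ht1 : t ≤ 1) (a b : ℝ) :
    ((1 - t) * a + t * b) ^ 2 ≤ (1 - t) * a ^ 2 + t * b ^ 2 := by
  nlinarith [mul_nonneg (mul_nonneg ht0 (sub_nonneg.2 ht1)) (sq_nonneg (a - b))]

/-- The closed disk `|φ - p| ≤ r` of twists is convex: the segment from `φ₀` to `φ` stays in it.
[folklore] -/
theorem seg_mem_disk {p φ₀ φ : Fin 2 → ℝ} {r t : ℝ}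
    (h₀ : (φ₀ 0 - p 0) ^ 2 + (φ₀ 1 - p 1) ^ 2 ≤ r ^ 2)
    (h₁ : (φ 0 - p 0) ^ 2 + (φ 1 - p 1) ^ 2 ≤ r ^ 2) (ht0 : 0 ≤ t) (ht1 : t ≤ 1) :
    ((φ₀ + t • (φ - φ₀)) 0 - p 0) ^ 2 + ((φ₀ + t • (φ - φ₀)) 1 - p 1) ^ 2 ≤ r ^ 2 := by
  have e0 : (φ₀ + t • (φ - φ₀)) 0 - p 0 = (1 - t) * (φ₀ 0 - p 0) + t * (φ 0 - p 0) := by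
    simp only [Pi.add_apply, Pi.smul_apply, Pi.sub_apply, smul_eq_mul]; ring
  have e1 : (φ₀ + t • (φ - φ₀)) 1 - p 1 = (1 - t) * (φ₀ 1 - p 1) + t * (φ 1 - p 1) := by
    simp only [Pi.add_apply, Pi.smul_apply, Pi.sub_apply, smul_eq_mul]; ring
  rw [e0, e1]
  have c0 := sq_convex_comb_le ht0 ht1 (φ₀ 0 - p 0) (φ 0 - p 0)
  have c1 := sq_convex_comb_le ht0 ht1 (φ₀ 1 - p 1) (φ 1 - p 1)
  nlinarith [mul_le_mul_of_nonneg_left h₀ (sub_nonneg.2 ht1), mul_le_mul_of_nonneg_left h₁ ht0]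

/-- Distances along the segment: `dist(φ₀ + t(φ-φ₀), φ₀ + t'(φ-φ₀)) = |t - t'| · dist(φ, φ₀)`. [folklore] -/
theorem dist_seg (φ₀ φ : Fin 2 → ℝ) (t t' : ℝ) :
    dist (φ₀ + t • (φ - φ₀)) (φ₀ + t' • (φ - φ₀)) = |t - t'| * dist φ φ₀ := by
  rw [dist_eq_norm, dist_eq_norm, ← Real.norm_eq_abs, ← norm_smul, sub_smul]
  congr 1
  abel

end Geometry

/-! ### Local constancy of the translation sign -/

/-- A nonzero multiple of a sector ground state is a sector ground state. [folklore] -/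
theorem isGroundStateInSector_smul {Λ : Type*} [LinearOrder Λ] [Fintype Λ]
    {H : Matrix (Finset (Orb Λ)) (Finset (Orb Λ)) ℂ} {N : ℕ} {M : ℝ} {χ : Fock (Orb Λ)}
    (hχ : IsGroundStateInSector H N M χ) {c : ℂ} (hc : c ≠ 0) :
    IsGroundStateInSector H N M (c • χ) :=
  ⟨Submodule.smul_mem _ c hχ.1, smul_ne_zero hc hχ.2.1, by rw [mulVec_smul, hχ.2.2, smul_comm]⟩

section LocallyConstant

variable (L : ℕ) [NeZero L]

/-- **Nearby twists in a disk of uniqueness carry the same translation sign.**  If the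
`(N, S^z = 0)` sector ground state of `H_L(U,φ)` is unique up to scalars on the closed disk
`|φ - p| ≤ r`, then there is `δ > 0` such that for twists `φ, φ'` of the disk with `dist φ φ' < δ`,
sector ground states `χ` at `φ` and `χ'` at `φ'` with `U_v χ = a χ`, `U_v χ' = a' χ'` have `a = a'`.
(`uniform_overlap` with `ε = 1` gives `⟨χ̂, χ̂'⟩ ≠ 0` for the unit multiples; unitarity of `U_v`
gives `⟨χ, χ'⟩ = conj(a) a' ⟨χ, χ'⟩`; and `a = ±1` by `fockTranslate_mulVec_eq_self_or_eq_neg`.)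
Kato (1966) II §5.1; Hatsugai (2006). [folklore] -/
theorem fockTranslate_sign_eq_of_near (U : ℝ) (N : ℕ) (p : Fin 2 → ℝ) {r : ℝ} (hr : 0 ≤ r)
    (huniq : ∀ φ : Fin 2 → ℝ, (φ 0 - p 0) ^ 2 + (φ 1 - p 1) ^ 2 ≤ r ^ 2 →
      ∀ χ₁ χ₂ : Fock (Orb (FermionTorus 2 L)),
      IsGroundStateInSector (spinTwistedHubbardTorus L U φ) N 0 χ₁ →
      IsGroundStateInSector (spinTwistedHubbardTorus L U φ) N 0 χ₂ → ∃ z : ℂ, χ₂ = z • χ₁)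
    (v : TorusSite 2 L) :
    ∃ δ : ℝ, 0 < δ ∧ ∀ φ φ' : Fin 2 → ℝ,
      (φ 0 - p 0) ^ 2 + (φ 1 - p 1) ^ 2 ≤ r ^ 2 → (φ' 0 - p 0) ^ 2 + (φ' 1 - p 1) ^ 2 ≤ r ^ 2 →
      dist φ φ' < δ → ∀ (χ χ' : Fock (Orb (FermionTorus 2 L))) (a a' : ℂ),
      IsGroundStateInSector (spinTwistedHubbardTorus L U φ) N 0 χ →
      IsGroundStateInSector (spinTwistedHubbardTorus L U φ') N 0 χ' →
      (fockTranslate v).val *ᵥ χ = a • χ → (fockTranslate v).val *ᵥ χ' = a' • χ' → a = a' := by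
  classical
  by_cases hp : ∃ s : Finset (Orb (FermionTorus 2 L)),
      s.card = N ∧ (upPart s).card = (downPart s).card
  · have hsg := fun φ : Fin 2 → ℝ => sector_groundState (spinTwistedHubbardTorus L U φ)
      (spinTwistedHubbardTorus_isHermitian L U φ)
      (fun s : Finset (Orb (FermionTorus 2 L)) => s.card = N ∧ (upPart s).card = (downPart s).card)
      hp (fun s s' hs hs' => spinTwistedHubbardTorus_apply_eq_zero L U φ N s s' hs hs')
      (szSector N 0) (mem_szSector_zero_iff_coord N)
    obtain ⟨δ, hδ, hov⟩ := uniform_overlap (szSector N 0) (spinTwistedHubbardTorus L U)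
      (continuous_spinTwistedHubbardTorus L U) p hr (fun φ => (hsg φ).2)
      (fun φ hφ χ₁ χ₂ h₁ h₂ => huniq φ hφ χ₁ χ₂ h₁ h₂) one_pos
    refine ⟨δ, hδ, fun φ φ' hφ hφ' hd χ χ' a a' hχ hχ' ha ha' => ?_⟩
    -- `a = ±1`
    have huφ : ∀ χ'', IsGroundStateInSector (spinTwistedHubbardTorus L U φ) N 0 χ'' →
        ∃ z : ℂ, χ'' = z • χ := fun χ'' h => huniq φ hφ χ χ'' hχ h
    have ha1 : a = 1 ∨ a = -1 := by
      rcases fockTranslate_mulVec_eq_self_or_eq_neg L hχ huφ v with h | h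
      · left
        have h2 : (a - 1) • χ = 0 := by rw [sub_smul, one_smul, ← ha, h, sub_self]
        exact sub_eq_zero.1 ((smul_eq_zero.1 h2).resolve_right hχ.2.1)
      · right
        have h2 : (a - (-1)) • χ = 0 := by rw [sub_smul, neg_one_smul, ← ha, h, sub_self]
        exact sub_eq_zero.1 ((smul_eq_zero.1 h2).resolve_right hχ.2.1)
    -- unit multiples and their non-vanishing overlap
    obtain ⟨c, hc, hcu⟩ := exists_smul_unit hχ.2.1
    obtain ⟨c', hc', hcu'⟩ := exists_smul_unit hχ'.2.1
    have hov1 := hov φ φ' hφ hφ' hd (c • χ) (c' • χ') (isGroundStateInSector_smul hχ hc) hcu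
      (isGroundStateInSector_smul hχ' hc') hcu'
    have hne : star χ ⬝ᵥ χ' ≠ 0 := by
      intro h0
      have : star (c • χ) ⬝ᵥ (c' • χ') = 0 := by
        rw [star_smul, smul_dotProduct, dotProduct_smul, h0, smul_zero, smul_zero]
      rw [this, norm_zero] at hov1
      norm_num at hov1
    -- unitarity of `U_v`
    have hU := star_fockRelabel_mulVec_dotProduct_fockRelabel_mulVec (Orb.translate v) χ χ'
    rw [show (fockRelabel (Orb.translate v)).val *ᵥ χ = a • χ from ha,
      show (fockRelabel (Orb.translate v)).val *ᵥ χ' = a' • χ' from ha', star_smul, smul_dotProduct,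
      dotProduct_smul, smul_smul, smul_eq_mul] at hU
    have haa : star a * a' = 1 := mul_right_cancel₀ hne (hU.trans (one_mul _).symm)
    rcases ha1 with rfl | rfl
    · rw [star_one, one_mul] at haa
      exact haa.symm
    · rw [star_neg, star_one, neg_one_mul, neg_eq_iff_eq_neg] at haa
      exact haa.symm
  · -- empty sector: no ground states at all
    push Not at hp
    refine ⟨1, one_pos, fun φ φ' _ _ _ χ χ' a a' hχ _ _ _ => ?_⟩
    obtain ⟨hmem, hne, -⟩ := hχ
    exact (hne (funext fun s =>
      (mem_szSector_zero_iff_coord N _).1 hmem s fun h => hp s h.1 h.2)).elim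

/-- **The translation sign is constant on a disk of uniqueness.**  If the `(N, S^z = 0)` sector
ground state of `H_L(U,φ)` is unique up to scalars on the closed disk `|φ - p| ≤ r`, then for every
translation `v` there is ONE scalar `s` (necessarily `± 1` when ground states exist) with
`U_v χ = s χ` for every sector ground state `χ` at every twist of the disk: the crystal momentum of
the ground state does not move as long as the ground state stays non-degenerate.  (Chain the segment
from a base twist in steps shorter than the `δ` of `fockTranslate_sign_eq_of_near`; the disk is
convex.) Kato (1966) II §5.1; Hatsugai (2006). [folklore] -/
theorem fockTranslate_sign_const_on_disk (U : ℝ) (N : ℕ) (p : Fin 2 → ℝ) {r : ℝ} (hr : 0 ≤ r)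
    (huniq : ∀ φ : Fin 2 → ℝ, (φ 0 - p 0) ^ 2 + (φ 1 - p 1) ^ 2 ≤ r ^ 2 →
      ∀ χ₁ χ₂ : Fock (Orb (FermionTorus 2 L)),
      IsGroundStateInSector (spinTwistedHubbardTorus L U φ) N 0 χ₁ →
      IsGroundStateInSector (spinTwistedHubbardTorus L U φ) N 0 χ₂ → ∃ z : ℂ, χ₂ = z • χ₁)
    (v : TorusSite 2 L) :
    ∃ s : ℂ, ∀ φ : Fin 2 → ℝ, (φ 0 - p 0) ^ 2 + (φ 1 - p 1) ^ 2 ≤ r ^ 2 →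
      ∀ χ : Fock (Orb (FermionTorus 2 L)),
      IsGroundStateInSector (spinTwistedHubbardTorus L U φ) N 0 χ → (fockTranslate v).val *ᵥ χ = s • χ := by
  classical
  obtain ⟨δ, hδ, hnear⟩ := fockTranslate_sign_eq_of_near L U N p hr huniq v
  -- eigenvalue of a ground state at a twist of the disk
  have heig : ∀ φ : Fin 2 → ℝ, (φ 0 - p 0) ^ 2 + (φ 1 - p 1) ^ 2 ≤ r ^ 2 →
      ∀ χ, IsGroundStateInSector (spinTwistedHubbardTorus L U φ) N 0 χ →
      ∃ a : ℂ, (fockTranslate v).val *ᵥ χ = a • χ := fun φ hφ χ hχ =>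
    exists_fockTranslate_mulVec_eq_smul L hχ (fun χ'' h => huniq φ hφ χ χ'' hχ h) v
  by_cases hex : ∃ φ₀ : Fin 2 → ℝ, (φ₀ 0 - p 0) ^ 2 + (φ₀ 1 - p 1) ^ 2 ≤ r ^ 2 ∧
      ∃ χ₀, IsGroundStateInSector (spinTwistedHubbardTorus L U φ₀) N 0 χ₀
  · obtain ⟨φ₀, hφ₀, χ₀, hχ₀⟩ := hex
    obtain ⟨a₀, ha₀⟩ := heig φ₀ hφ₀ χ₀ hχ₀
    refine ⟨a₀, fun φ hφ χ hχ => ?_⟩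
    -- the sector is nonempty, so every twist carries a sector ground state
    have hp : ∃ s : Finset (Orb (FermionTorus 2 L)), s.card = N ∧ (upPart s).card = (downPart s).card := by
      by_contra hp
      push Not at hp
      obtain ⟨hmem, hne, -⟩ := hχ₀
      exact hne (funext fun s => (mem_szSector_zero_iff_coord N _).1 hmem s fun h => hp s h.1 h.2)
    have hexist : ∀ ψ : Fin 2 → ℝ, ∃ ξ, IsGroundStateInSector (spinTwistedHubbardTorus L U ψ) N 0 ξ :=
      fun ψ => by
        obtain ⟨⟨ξ, hξK, hξ0, hξe⟩, -⟩ := sector_groundState (spinTwistedHubbardTorus L U ψ)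
          (spinTwistedHubbardTorus_isHermitian L U ψ)
          (fun s : Finset (Orb (FermionTorus 2 L)) => s.card = N ∧ (upPart s).card = (downPart s).card)
          hp (fun s s' hs hs' => spinTwistedHubbardTorus_apply_eq_zero L U ψ N s s' hs hs')
          (szSector N 0) (mem_szSector_zero_iff_coord N)
        exact ⟨ξ, hξK, hξ0, hξe⟩
    -- the chain along the segment from `φ₀` to `φ`
    set d := dist φ φ₀ with hd
    obtain ⟨m, hm⟩ : ∃ m : ℕ, d / δ < m := exists_nat_gt (d / δ)
    have hm0 : 0 < (m : ℝ) := lt_of_le_of_lt (div_nonneg dist_nonneg hδ.le) hm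
    have hstep : d / m < δ := by
      rw [div_lt_iff₀ hm0]
      calc d = d / δ * δ := by field_simp
        _ < m * δ := mul_lt_mul_of_pos_right hm hδ
        _ = δ * m := mul_comm _ _
    set seg : ℕ → (Fin 2 → ℝ) := fun j => φ₀ + ((j : ℝ) / m) • (φ - φ₀) with hseg
    have hsegmem : ∀ j : ℕ, j ≤ m → (seg j 0 - p 0) ^ 2 + (seg j 1 - p 1) ^ 2 ≤ r ^ 2 := fun j hj =>
      seg_mem_disk hφ₀ hφ (div_nonneg (Nat.cast_nonneg j) hm0.le)
        ((div_le_one hm0).2 (by exact_mod_cast hj))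
    have hsegdist : ∀ j : ℕ, dist (seg j) (seg (j + 1)) < δ := fun j => by
      have h := dist_seg φ₀ φ ((j : ℝ) / m) (((j + 1 : ℕ) : ℝ) / m)
      rw [show ((j : ℝ) / m) - (((j + 1 : ℕ) : ℝ) / m) = -(1 / m) by push_cast; ring, abs_neg,
        abs_of_pos (by positivity), one_div_mul_eq_div] at h
      simp only [hseg]
      rw [h]
      exact hstep
    -- induction along the chain: every ground state at `seg j` has eigenvalue `a₀`
    have hchain : ∀ j : ℕ, j ≤ m → ∀ ξ a, IsGroundStateInSector (spinTwistedHubbardTorus L U (seg j)) N 0 ξ →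
        (fockTranslate v).val *ᵥ ξ = a • ξ → a = a₀ := by
      intro j
      induction j with
      | zero =>
        intro _ ξ a hξ ha
        have hseg0 : seg 0 = φ₀ := by simp [hseg]
        rw [hseg0] at hξ
        exact (hnear φ₀ φ₀ hφ₀ hφ₀ (by rw [dist_self]; exact hδ) χ₀ ξ a₀ a hχ₀ hξ ha₀ ha).symm
      | succ j ih =>
        intro hj ξ a hξ ha
        obtain ⟨ξ', hξ'⟩ := hexist (seg j)
        obtain ⟨a', ha'⟩ := heig (seg j) (hsegmem j (by omega)) ξ' hξ'
        have h1 : a' = a₀ := ih (by omega) ξ' a' hξ' ha'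
        have h2 : a' = a := hnear (seg j) (seg (j + 1)) (hsegmem j (by omega)) (hsegmem (j + 1) hj)
          (hsegdist j) ξ' ξ a' a hξ' hξ ha' ha
        rw [← h2, h1]
    -- the endpoint of the chain is `φ`
    have hsegm : seg m = φ := by
      simp only [hseg]
      rw [div_self hm0.ne', one_smul, add_sub_cancel]
    obtain ⟨a, ha⟩ := heig φ hφ χ hχ
    have hξ : IsGroundStateInSector (spinTwistedHubbardTorus L U (seg m)) N 0 χ := by rw [hsegm]; exact hχ
    rw [ha, hchain m le_rfl χ a hξ ha]
  · -- no ground state anywhere on the disk: vacuous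
    push Not at hex
    exact ⟨1, fun φ hφ χ hχ => (hex φ hφ χ hχ).elim⟩

/-- **Registered sub-goal `stub_momentumLocallyConstant` of crux stmt-HubbardSuperconductivity-10395**
(lead c11, line `birth`; structural input to stub C): the statement of
`fockTranslate_sign_const_on_disk` with all binders explicit and all names fully qualified — on a
closed disk of twists on which the `(N, S^z = 0)` sector ground state of `H_L(U,φ)` is unique, the
translation eigenvalue (crystal momentum) of the ground state is the same at every twist.
Kato (1966) II §5.1; Hatsugai (2006). [folklore] -/
theorem stub_momentumLocallyConstant : ∀ (L : ℕ) [NeZero L] (U : ℝ) (N : ℕ) (p : Fin 2 → ℝ) (r : ℝ), 0 ≤ r → (∀ φ : Fin 2 → ℝ, (φ 0 - p 0) ^ 2 + (φ 1 - p 1) ^ 2 ≤ r ^ 2 → ∀ χ₁ χ₂ : Literature.MathematicalPhysics.QuantumLattice.Fock (Literature.MathematicalPhysics.QuantumLattice.Orb (Literature.MathematicalPhysics.QuantumLattice.FermionTorus 2 L)), Literature.MathematicalPhysics.QuantumLattice.IsGroundStateInSector (Literature.MathematicalPhysics.QuantumLattice.spinTwistedHubbardTorus L U φ) N 0 χ₁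 → Literature.MathematicalPhysics.QuantumLattice.IsGroundStateInSector (Literature.MathematicalPhysics.QuantumLattice.spinTwistedHubbardTorus L U φ) N 0 χ₂ → ∃ z : ℂ, χ₂ = z • χ₁) → ∀ v : Literature.Probability.LatticeModels.TorusSite 2 L, ∃ s : ℂ, ∀ φ : Fin 2 → ℝ, (φ 0 - p 0) ^ 2 + (φ 1 - p 1) ^ 2 ≤ r ^ 2 → ∀ χ : Literature.MathematicalPhysics.QuantumLattice.Fock (Literature.MathematicalPhysics.QuantumLattice.Orb (Literature.MathematicalPhysics.QuantumLattice.FermionTorus 2 L)), Literature.MathematicalPhysics.QuantumLattice.IsGroundStateInSector (Literature.MathematicalPhysics.QuantumLattice.spinTwistedHubbardTorus L U φ) N 0 χ → Matrix.mulVec (Literature.MathematicalPhysics.QuantumLattice.fockTranslate v).val χ = s • χ :=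
  fun L _ U N p _ hr huniq v => fockTranslate_sign_const_on_disk L U N p hr huniq v

end LocallyConstant

end Summit.HubbardSuperconductivity.HubbardSuperconductivity.Theorems.NodalDiracTwist.BridgeNodalToDWave

end
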